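import Mathlib
import Summits.Ventures.HodgeRepro.Tier4.Common.AdelicRTF
import Summits.Ventures.HodgeRepro.Tier4.Line4.TwoTorusCut
import Summits.Ventures.HodgeRepro.Tier4.Line4.Isolation

/-!
# Tier 4 · Line 4 — W4 / W5 DISPLAYED and the rung `W4 ∧ W5 → W3` (DECOMPOSITION A of the wall `mixed_two_torus`)

p1's cut (`TwoTorusCut`) reduces the wall to `W3 = ∃ V, IsAdmissible … V ∧ HasNonzeroMixedPeriod W R V` (+ `hunit`).
plan-4's DECOMPOSITION A (S12873) writes a two-character double period `J` of a Hecke test function `f` as a finite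
spectral sum `∑_i λ_i(f) · P_T(v′_i)` over a family of admissible cuspidal subspaces `V i` with Hecke eigenvalues
`λ_i` (the eigenvalue clause of `rightRegular` spelled inline — typer-2's `IsHeckeEigenvalue` of `Common/LocalTorus`, p671906, verbatim; to be cited by name once that module serves) and Riesz vectors `v′_i` (W4, `IsTwoTorusSpectralExpansion`), and asserts the
geometric main term makes `J ≠ 0` (W5).  BOTH are UNPRINTED automorphic inputs on held pages (lit-1 S12876) and are
DISPLAYED here as hypotheses — nothing in this module asserts either.  What IS proved: the glue `W4 ∧ W5 → W3`
(`exists_admissible_mixed_of_spectral`), by `Isolation.exists_ne_zero_of_sum_mul_ne_zero`.  HC_CM is NOT proved by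
anyone in this repository.
-/

set_option autoImplicit false

noncomputable section

namespace Summit.Ventures.HodgeRepro.Tier4.Line4

open Summit.Ventures.HodgeRepro.Tier4.Common MeasureTheory NumberField

variable {k : Type} [Field k] [NumberField k] (W : PlaneData k)
variable [MeasurableSpace (torusT W)] [MeasurableSpace (torusT' W)] (R : RTFData W)

/-- **W4 (displayed)**: the number `J` (meant: the two-character double period `∫∫_{D_T × D_{T′}} K_f χ χ′`) is the
finite spectral sum `∑ i, λ_i · P_T(v′_i)` of a family `V i` of subspaces with Hecke eigenvalues `λ_i` of `f` and Riesz
vectors `v′_i`.  A Prop on the data; nothing is asserted about its truth. -/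
def IsTwoTorusSpectralExpansion [MeasurableSpace (GA W)] (μ : Measure (GA W)) (f : GA W → ℂ) (J : ℂ)
    {n : ℕ} (V : Fin n → Submodule ℂ (GA W → ℂ)) (lam : Fin n → ℂ) (v' : Fin n → (GA W → ℂ)) : Prop :=
  (∀ i, ∀ φ ∈ V i, rightRegular W μ f φ = fun x => lam i * φ x) ∧ (∀ i, IsRieszVector W R (V i) (v' i)) ∧
    J = ∑ i, lam i * periodLin W R.μT R.DT R.chi (restrictTo W (torusT W) (v' i))

/-- W6 applied to W4: if the spectral expansion holds and `J ≠ 0` (W5), some member `V i` of the family has a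
non-zero mixed period (and a non-zero eigenvalue `λ_i`). -/
theorem exists_hasNonzeroMixedPeriod_of_spectral [MeasurableSpace (GA W)] (μ : Measure (GA W)) (f : GA W → ℂ)
    (J : ℂ) {n : ℕ} (V : Fin n → Submodule ℂ (GA W → ℂ)) (lam : Fin n → ℂ) (v' : Fin n → (GA W → ℂ))
    (hS : IsTwoTorusSpectralExpansion W R μ f J V lam v') (hJ : J ≠ 0) :
    ∃ i, lam i ≠ 0 ∧ HasNonzeroMixedPeriod W R (V i) := by
  obtain ⟨_, hv', hJeq⟩ := hS
  rw [hJeq] at hJ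
  obtain ⟨i, _, hlam, hP⟩ := Isolation.exists_ne_zero_of_sum_mul_ne_zero Finset.univ lam
    (fun i => periodLin W R.μT R.DT R.chi (restrictTo W (torusT W) (v' i))) hJ
  exact ⟨i, hlam, v' i, hv' i, hP⟩

/-- **The rung `W4 ∧ W5 → W3`**: a spectral expansion over a family of ADMISSIBLE subspaces with `J ≠ 0` gives the
narrowed wall `W3` of `TwoTorusCut` — an admissible `V` with a non-zero mixed period.  The two hypotheses
`hS` (W4) and `hJ` (W5) are the displayed automorphic inputs; `hadm` is the K-type bookkeeping of the family
(the archimedean test function in the weight-3 discrete series, plan-4 §11). -/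
theorem exists_admissible_mixed_of_spectral [MeasurableSpace (GA W)] (μ : Measure (GA W)) (f : GA W → ℂ)
    (J : ℂ) {n : ℕ} (V : Fin n → Submodule ℂ (GA W → ℂ)) (lam : Fin n → ℂ) (v' : Fin n → (GA W → ℂ))
    (q : QuadData k) (g g' : Matrix (Fin 4) (Fin 4) k) (w₀ : InfinitePlace k) (eP eM eP' eM' : InfinitePlace k → ℤ)
    (hadm : ∀ i, IsAdmissible W q g g' w₀ eP eM eP' eM' (V i))
    (hS : IsTwoTorusSpectralExpansion W R μ f J V lam v') (hJ : J ≠ 0) :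
    ∃ V₀ : Submodule ℂ (GA W → ℂ), IsAdmissible W q g g' w₀ eP eM eP' eM' V₀ ∧ HasNonzeroMixedPeriod W R V₀ := by
  obtain ⟨i, _, hP⟩ := exists_hasNonzeroMixedPeriod_of_spectral W R μ f J V lam v' hS hJ
  exact ⟨V i, hadm i, hP⟩

end Summit.Ventures.HodgeRepro.Tier4.Line4

end
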